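import Mathlib.MeasureTheory.Integral.DivergenceTheorem
import Mathlib.Analysis.Calculus.Deriv.Shift
import Literature.Analysis.Convexity.CanonicalComplex
import Literature.ModelTheory.ExponentialFields.SemialgebraicC1Triangulation
import HarnessLib

/-!
# Whitney fields from simplexwise `C¹` data on coordinate complexes

Topic `Literature/ModelTheory/ExponentialFields` — the gluing step between the panel-beating
engine (`SemialgebraicPanelBeating*.lean`, after [CzaplaPawlucki2018, §2 Part II]) and Whitney's
extension theorem in the `C¹` layer of the `C¹`-triangulation theorem [OhmotoShiota2017]: a map
`G` on the underlying space of a finite coordinate complex which is continuous, differentiable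
*along each open simplex* with derivative the restriction of a *continuous* field `A` of linear
maps, satisfies the uniform Whitney remainder estimate
`‖G y - G x - A x (y - x)‖ = o(‖y - x‖)` on `|K|` — the hypothesis of Whitney's `C¹` extension
theorem [EvansGariepy2015, Thm. 6.10].  Two ingredients:

* `eq_integral_of_hasDerivAt_pieces` — **the segment lemma**: along a segment covered by
  finitely many convex pieces on each of which `G` has directional derivatives `A z w` in the
  directions of the piece, `t ↦ G (x + t (y - x))` is continuous and differentiable off finitely
  many parameters, so `G y - G x = ∫₀¹ A (x + t(y-x)) (y - x) dt` (fundamental theorem of calculus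
  off a countable set) and `‖G y - G x - A x (y-x)‖ ≤ η ‖y - x‖` whenever `‖A z - A x‖ ≤ η` on the
  segment;
* `exists_route` — **quasiconvexity of coordinate polyhedra**: two nearby points `x, y` of `|K|`
  are joined through a point `z` of a common face with `[x, z], [z, y] ⊆ |K|` inside closed
  simplices and `‖x - z‖ + ‖z - y‖ ≤ C ‖x - y‖`;

and the conclusion `whitneyField_of_isCoordinate`.

No named facts are introduced.

## References

* [EvansGariepy2015] L. C. Evans, R. F. Gariepy, *Measure Theory and Fine Properties of
  Functions*, revised ed., CRC 2015, §6.5 Thm. 6.10 (hypothesis `(⋆)`).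
* [CzaplaPawlucki2018] M. Czapla, W. Pawłucki, *Strict `C¹`-triangulations in o-minimal
  structures*, TMNA 52 (2018), §2 Part II (end of proof: "all first-order partial derivatives
  continuous on `|K|`, hence by Whitney's extension theorem …").
-/

open Set Filter MeasureTheory intervalIntegral
open _root_.Topology

namespace Literature.ModelTheory.ExponentialFields

open Literature.Analysis.Convexity

/-! ## The segment lemma -/

section Segment

variable {V F : Type*} [NormedAddCommGroup V] [NormedSpace ℝ V] [NormedAddCommGroup F]
  [NormedSpace ℝ F] [CompleteSpace F]

/-- The parametrisation of the segment from `x` to `y`. [folklore] -/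
theorem lineMap_eq (x y : V) (t : ℝ) : AffineMap.lineMap x y t = x + t • (y - x) := by
  rw [AffineMap.lineMap_apply_module', add_comm]

/-- Parameters of a segment inside a convex piece form an order-connected set. [folklore] -/
theorem ordConnected_segmentParams {P : Set V} (hP : Convex ℝ P) (x y : V) :
    OrdConnected {t : ℝ | x + t • (y - x) ∈ P} := by
  have h : {t : ℝ | x + t • (y - x) ∈ P} = (AffineMap.lineMap x y : ℝ →ᵃ[ℝ] V) ⁻¹' P := by
    ext t
    rw [mem_setOf_eq, mem_preimage, lineMap_eq]
  rw [h]
  exact (hP.affine_preimage _).ordConnected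

/-- **The segment lemma.** Let finitely many convex pieces `P i` be given, each with a space of
directions `D i` containing the differences of its points, and let `G` have, at every point `z`
of `P i` and in every direction `w ∈ D i`, the derivative `A z w` along the line `τ ↦ z + τ w`.
If the segment `[x, y]` is covered by the pieces and `G` is continuous on it, then
`G y - G x = ∫₀¹ A (x + t (y - x)) (y - x) dt`. [cite: EvansGariepy2015, §6.5 (hypothesis (⋆))] -/
theorem eq_integral_of_hasDerivAt_pieces {ι : Type*} [Finite ι] (P : ι → Set V)
    (hP : ∀ i, Convex ℝ (P i)) (D : ι → Submodule ℝ V) (hPD : ∀ i, ∀ z ∈ P i, ∀ z' ∈ P i, z' - z ∈ D i)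
    {G : V → F} {A : V → V →L[ℝ] F}
    (hderiv : ∀ i, ∀ z ∈ P i, ∀ w ∈ D i, HasDerivAt (fun τ : ℝ => G (z + τ • w)) (A z w) 0)
    {x y : V} (hcover : ∀ t ∈ Icc (0 : ℝ) 1, ∃ i, x + t • (y - x) ∈ P i)
    (hG : ContinuousOn (fun t : ℝ => G (x + t • (y - x))) (Icc 0 1))
    (hA : ContinuousOn (fun t : ℝ => A (x + t • (y - x)) (y - x)) (Icc 0 1)) :
    G y - G x = ∫ t in (0 : ℝ)..1, A (x + t • (y - x)) (y - x) := by
  classical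
  haveI := Fintype.ofFinite ι
  -- parameter sets of the pieces and the finite exceptional set of their endpoints
  let T : ι → Set ℝ := fun i => {t : ℝ | x + t • (y - x) ∈ P i} ∩ Icc 0 1
  have hTord : ∀ i, OrdConnected (T i) := fun i =>
    (ordConnected_segmentParams (hP i) x y).inter ordConnected_Icc
  have hTbdd : ∀ i, BddBelow (T i) ∧ BddAbove (T i) := fun i =>
    ⟨⟨0, fun t ht => ht.2.1⟩, ⟨1, fun t ht => ht.2.2⟩⟩
  let s : Set ℝ := ⋃ i, {sInf (T i), sSup (T i)}
  have hs : s.Countable := (Set.finite_iUnion fun i => (Set.toFinite _)).countable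
  -- the derivative off `s`
  have hd : ∀ t ∈ Ioo (0 : ℝ) 1 \ s, HasDerivAt (fun τ : ℝ => G (x + τ • (y - x)))
      (A (x + t • (y - x)) (y - x)) t := by
    rintro t ⟨ht, hts⟩
    obtain ⟨i, hi⟩ := hcover t ⟨ht.1.le, ht.2.le⟩
    have htT : t ∈ T i := ⟨hi, ht.1.le, ht.2.le⟩
    have hne : t ≠ sInf (T i) ∧ t ≠ sSup (T i) := by
      constructor <;> intro h <;> exact hts (mem_iUnion.mpr ⟨i, by simp [h]⟩)
    -- points of `T i` on both sides of `t`
    have hlt : sInf (T i) < t := lt_of_le_of_ne (csInf_le (hTbdd i).1 htT) (Ne.symm hne.1)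
    have hgt : t < sSup (T i) := lt_of_le_of_ne (le_csSup (hTbdd i).2 htT) hne.2
    obtain ⟨t₁, ht₁T, ht₁⟩ := exists_lt_of_csInf_lt ⟨t, htT⟩ hlt
    obtain ⟨t₂, ht₂T, ht₂⟩ := exists_lt_of_lt_csSup ⟨t, htT⟩ hgt
    -- the direction `y - x` lies in `D i`
    have hw : y - x ∈ D i := by
      have h := hPD i _ ht₁T.1 _ ht₂T.1
      have heq : x + t₂ • (y - x) - (x + t₁ • (y - x)) = (t₂ - t₁) • (y - x) := by
        rw [sub_smul]; abel
      rw [heq] at h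
      have hne' : t₂ - t₁ ≠ 0 := sub_ne_zero.mpr (ht₁.trans ht₂).ne'
      have := (D i).smul_mem (t₂ - t₁)⁻¹ h
      rwa [smul_smul, inv_mul_cancel₀ hne', one_smul] at this
    -- derivative at `t` from the derivative at `0` of the shifted line
    have h0 := hderiv i _ hi _ hw
    have h0' : HasDerivAt (fun τ : ℝ => G (x + t • (y - x) + τ • (y - x)))
        (A (x + t • (y - x)) (y - x)) (t - t) := by rwa [sub_self]
    have hcomp : HasDerivAt (fun τ : ℝ => G (x + t • (y - x) + (τ - t) • (y - x)))
        (A (x + t • (y - x)) (y - x)) t := HasDerivAt.comp_sub_const t t h0'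
    refine hcomp.congr_of_eventuallyEq (Eventually.of_forall fun τ => ?_)
    show G (x + τ • (y - x)) = G (x + t • (y - x) + (τ - t) • (y - x))
    congr 1
    rw [sub_smul]
    abel
  have h := MeasureTheory.integral_eq_of_hasDerivAt_off_countable_of_le
    (fun t : ℝ => G (x + t • (y - x))) (fun t => A (x + t • (y - x)) (y - x)) zero_le_one hs hG hd
    (hA.intervalIntegrable_of_Icc zero_le_one)
  simpa using h.symm

/-- **The remainder estimate along a segment**: under the hypotheses of the segment lemma, if
`‖A z - A x‖ ≤ η` along the segment then `‖G y - G x - A x (y - x)‖ ≤ η ‖y - x‖`.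
[cite: EvansGariepy2015, §6.5 (hypothesis (⋆))] -/
theorem norm_sub_sub_le_of_pieces {ι : Type*} [Finite ι] (P : ι → Set V)
    (hP : ∀ i, Convex ℝ (P i)) (D : ι → Submodule ℝ V) (hPD : ∀ i, ∀ z ∈ P i, ∀ z' ∈ P i, z' - z ∈ D i)
    {G : V → F} {A : V → V →L[ℝ] F}
    (hderiv : ∀ i, ∀ z ∈ P i, ∀ w ∈ D i, HasDerivAt (fun τ : ℝ => G (z + τ • w)) (A z w) 0)
    {x y : V} (hcover : ∀ t ∈ Icc (0 : ℝ) 1, ∃ i, x + t • (y - x) ∈ P i)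
    (hG : ContinuousOn (fun t : ℝ => G (x + t • (y - x))) (Icc 0 1))
    (hA : ContinuousOn (fun t : ℝ => A (x + t • (y - x))) (Icc 0 1))
    {η : ℝ} (hη : ∀ t ∈ Icc (0 : ℝ) 1, ‖A (x + t • (y - x)) - A x‖ ≤ η) :
    ‖G y - G x - A x (y - x)‖ ≤ η * ‖y - x‖ := by
  have hA' : ContinuousOn (fun t : ℝ => A (x + t • (y - x)) (y - x)) (Icc 0 1) :=
    hA.clm_apply continuousOn_const
  rw [eq_integral_of_hasDerivAt_pieces P hP D hPD hderiv hcover hG hA']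
  have h1 : (∫ t in (0 : ℝ)..1, A (x + t • (y - x)) (y - x)) - A x (y - x) =
      ∫ t in (0 : ℝ)..1, (A (x + t • (y - x)) - A x) (y - x) := by
    have : (fun t : ℝ => (A (x + t • (y - x)) - A x) (y - x)) =
        fun t => A (x + t • (y - x)) (y - x) - A x (y - x) := by
      funext t; simp
    rw [this, intervalIntegral.integral_sub (hA'.intervalIntegrable_of_Icc zero_le_one)
      intervalIntegrable_const, intervalIntegral.integral_const]
    simp
  rw [h1]
  have h2 : ‖∫ t in (0 : ℝ)..1, (A (x + t • (y - x)) - A x) (y - x)‖ ≤ η * ‖y - x‖ * |1 - 0| := by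
    refine intervalIntegral.norm_integral_le_of_norm_le_const fun t ht => ?_
    rw [uIoc_of_le zero_le_one] at ht
    calc ‖(A (x + t • (y - x)) - A x) (y - x)‖ ≤ ‖A (x + t • (y - x)) - A x‖ * ‖y - x‖ :=
        ContinuousLinearMap.le_opNorm _ _
      _ ≤ η * ‖y - x‖ := mul_le_mul_of_nonneg_right (hη t ⟨ht.1.le, ht.2⟩) (norm_nonneg _)
  simpa using h2

end Segment

/-! ## Coordinate simplices: open simplices by support, directions -/

section Coord

variable {N : ℕ}

/-- The dot product with a coordinate vector reads off a coordinate. [folklore] -/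
theorem dot_single (j : Fin N) (x : Fin N → ℝ) : ∑ k, (Pi.single j (1 : ℝ) : Fin N → ℝ) k * x k = x j := by
  classical
  simp [Pi.single_apply, Finset.sum_ite_eq']

/-- **Open coordinate simplices by support**: `x` lies in the open simplex of `coordSimplex J` iff
it is positive on `J`, vanishes off `J` and has total mass one. [cite: Dries1998, Ch. 8 (1.4)] -/
theorem mem_openSimplex_coordSimplex_iff {J : Finset (Fin N)} {x : Fin N → ℝ} :
    x ∈ openSimplex ℝ (coordSimplex J) ↔ (∀ j ∈ J, 0 < x j) ∧ (∀ j ∉ J, x j = 0) ∧ ∑ j, x j = 1 := by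
  classical
  have hinjE : Set.InjOn (fun i : Fin N => (Pi.single i 1 : Fin N → ℝ)) (J : Set (Fin N)) :=
    single_one_injective.injOn
  have hcoord : ∀ (w : (Fin N → ℝ) → ℝ) (k : Fin N),
      (∑ y ∈ coordSimplex J, w y • y) k = if k ∈ J then w (Pi.single k 1) else 0 := by
    intro w k
    rw [coordSimplex, Finset.sum_image hinjE, Finset.sum_apply]
    simp only [Pi.smul_apply, Pi.single_apply, smul_eq_mul, mul_ite, mul_one, mul_zero]
    rw [Finset.sum_ite_eq]
  constructor
  · rintro ⟨w, hw0, hw1, hwx⟩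
    have hx : ∀ k, x k = if k ∈ J then w (Pi.single k 1) else 0 := fun k => by
      rw [← hwx, hcoord]
    refine ⟨fun j hj => ?_, fun j hj => ?_, ?_⟩
    · rw [hx j, if_pos hj]
      exact hw0 _ (single_mem_coordSimplex_iff.2 hj)
    · rw [hx j, if_neg hj]
    · rw [coordSimplex, Finset.sum_image hinjE] at hw1
      rw [← hw1, ← Finset.sum_subset (Finset.subset_univ J) (fun k _ hk => by rw [hx k, if_neg hk])]
      exact Finset.sum_congr rfl fun k hk => by rw [hx k, if_pos hk]
  · rintro ⟨hpos, hzero, hsum⟩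
    refine ⟨fun e => ∑ k, e k * x k, fun e he => ?_, ?_, ?_⟩
    · obtain ⟨j, hj, rfl⟩ := mem_coordSimplex_iff.1 he
      show 0 < ∑ k, (Pi.single j (1 : ℝ) : Fin N → ℝ) k * x k
      rw [dot_single]
      exact hpos j hj
    · rw [coordSimplex, Finset.sum_image hinjE]
      simp only [dot_single]
      rw [← hsum]
      exact (Finset.sum_subset (Finset.subset_univ J) fun k _ hk => hzero k hk)
    · funext k
      rw [hcoord]
      simp only [dot_single]
      by_cases hk : k ∈ J
      · rw [if_pos hk]
      · rw [if_neg hk, hzero k hk]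

/-- Open coordinate simplices are convex. [folklore] -/
theorem convex_openSimplex_coordSimplex (J : Finset (Fin N)) : Convex ℝ (openSimplex ℝ (coordSimplex J)) := by
  intro x hx y hy a b ha hb hab
  rw [mem_openSimplex_coordSimplex_iff] at hx hy ⊢
  refine ⟨fun j hj => ?_, fun j hj => ?_, ?_⟩
  · simp only [Pi.add_apply, Pi.smul_apply, smul_eq_mul]
    rcases ha.eq_or_lt with rfl | ha'
    · rw [zero_add] at hab
      rw [hab, zero_mul, one_mul, zero_add]
      exact hy.1 j hj
    · nlinarith [hx.1 j hj, hy.1 j hj, mul_pos ha' (hx.1 j hj)]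
  · simp [hx.2.1 j hj, hy.2.1 j hj]
  · simp only [Pi.add_apply, Pi.smul_apply, smul_eq_mul, Finset.sum_add_distrib, ← Finset.mul_sum,
      hx.2.2, hy.2.2, mul_one, hab]

/-- The support of a point. [folklore] -/
noncomputable def supp (x : Fin N → ℝ) : Finset (Fin N) := by
  classical exact Finset.univ.filter fun i => x i ≠ 0

/-- Membership in the support. [folklore] -/
theorem mem_supp_iff {x : Fin N → ℝ} {i : Fin N} : i ∈ supp x ↔ x i ≠ 0 := by
  classical
  simp [supp]

/-- A point of a standard face lies in the open simplex of its support. [folklore] -/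
theorem mem_openSimplex_coordSimplex_supp {I : Finset (Fin N)} {x : Fin N → ℝ} (hx : x ∈ stdFace (I : Set (Fin N))) :
    x ∈ openSimplex ℝ (coordSimplex (supp x)) ∧ supp x ⊆ I := by
  obtain ⟨hnn, hsum, hzero⟩ := hx
  refine ⟨mem_openSimplex_coordSimplex_iff.2 ⟨fun j hj => ?_, fun j hj => ?_, hsum⟩, fun j hj => ?_⟩
  · exact lt_of_le_of_ne (hnn j) (Ne.symm (mem_supp_iff.1 hj))
  · by_contra h
    exact hj (mem_supp_iff.2 h)
  · by_contra h
    exact mem_supp_iff.1 hj (hzero j h)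

/-- **The direction space of a coordinate simplex**: supported on `J`, total sum zero. [folklore] -/
def coordDir (J : Finset (Fin N)) : Submodule ℝ (Fin N → ℝ) where
  carrier := {w | (∀ j ∉ J, w j = 0) ∧ ∑ j, w j = 0}
  add_mem' {a b} ha hb := ⟨fun j hj => by simp [ha.1 j hj, hb.1 j hj],
    by simp only [Pi.add_apply, Finset.sum_add_distrib, ha.2, hb.2, add_zero]⟩
  zero_mem' := ⟨fun _ _ => rfl, by simp⟩
  smul_mem' c w hw := ⟨fun j hj => by simp [hw.1 j hj],
    by simp only [Pi.smul_apply, smul_eq_mul, ← Finset.mul_sum, hw.2, mul_zero]⟩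

/-- Membership in the direction space. [folklore] -/
theorem mem_coordDir_iff {J : Finset (Fin N)} {w : Fin N → ℝ} :
    w ∈ coordDir J ↔ (∀ j ∉ J, w j = 0) ∧ ∑ j, w j = 0 := Iff.rfl

/-- Differences of points of an open coordinate simplex are directions of it. [folklore] -/
theorem sub_mem_coordDir {J : Finset (Fin N)} {z z' : Fin N → ℝ} (hz : z ∈ openSimplex ℝ (coordSimplex J))
    (hz' : z' ∈ openSimplex ℝ (coordSimplex J)) : z' - z ∈ coordDir J := by
  obtain ⟨-, hz0, hzs⟩ := mem_openSimplex_coordSimplex_iff.1 hz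
  obtain ⟨-, hz0', hzs'⟩ := mem_openSimplex_coordSimplex_iff.1 hz'
  refine ⟨fun j hj => by simp [hz0 j hj, hz0' j hj], ?_⟩
  simp only [Pi.sub_apply, Finset.sum_sub_distrib, hzs, hzs', sub_self]

end Coord

/-! ## Routing through a common face (quasiconvexity of coordinate polyhedra) -/

section Route

variable {N : ℕ}

/-- Two nearby points of the standard simplex have intersecting supports. [folklore] -/
theorem supp_inter_nonempty {x y : Fin N → ℝ} (hx : x ∈ stdFace (Set.univ : Set (Fin N)))
    (hy : y ∈ stdFace (Set.univ : Set (Fin N))) (hxy : (N : ℝ) * ‖x - y‖ < 1) :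
    (supp x ∩ supp y).Nonempty := by
  classical
  obtain ⟨hxnn, hxsum, -⟩ := hx
  obtain ⟨hynn, -, -⟩ := hy
  -- a large coordinate of `x`
  have hN : 0 < N := by
    rcases Nat.eq_zero_or_pos N with h | h
    · subst h
      simp at hxsum
    · exact h
  obtain ⟨i, -, hi⟩ : ∃ i ∈ (Finset.univ : Finset (Fin N)), 1 / (N : ℝ) ≤ x i := by
    by_contra h
    push Not at h
    have : ∑ i, x i < ∑ _i : Fin N, 1 / (N : ℝ) := Finset.sum_lt_sum_of_nonempty
      (Finset.univ_nonempty_iff.mpr ⟨⟨0, hN⟩⟩) fun i _ => h i (Finset.mem_univ i)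
    rw [hxsum, Finset.sum_const, Finset.card_univ, Fintype.card_fin, nsmul_eq_mul] at this
    have hN' : (N : ℝ) ≠ 0 := by exact_mod_cast hN.ne'
    rw [mul_one_div_cancel hN'] at this
    exact lt_irrefl _ this
  refine ⟨i, Finset.mem_inter.mpr ⟨mem_supp_iff.2 ?_, mem_supp_iff.2 ?_⟩⟩
  · have : 0 < 1 / (N : ℝ) := by positivity
    linarith
  · have h1 : |x i - y i| ≤ ‖x - y‖ := by
      have := norm_le_pi_norm (x - y) i
      rwa [Pi.sub_apply, Real.norm_eq_abs] at this
    have hNpos : (0 : ℝ) < N := by exact_mod_cast hN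
    have h2 : ‖x - y‖ < 1 / N := by
      rw [lt_div_iff₀ hNpos, mul_comm]
      exact hxy
    intro hyi
    rw [hyi, sub_zero, abs_of_nonneg (hxnn i)] at h1
    linarith

/-- **The route point**: the normalised restriction of `x` to the common support `C`. [folklore] -/
noncomputable def routePt (x : Fin N → ℝ) (C : Finset (Fin N)) : Fin N → ℝ := by
  classical exact fun i => if i ∈ C then x i / ∑ j ∈ C, x j else 0

/-- Mass of `x` outside `C`. [folklore] -/
noncomputable def massOff (x : Fin N → ℝ) (C : Finset (Fin N)) : ℝ := ∑ j ∈ Finset.univ \ C, x j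

/-- Splitting the total mass. [folklore] -/
theorem sum_eq_sum_add_massOff (x : Fin N → ℝ) (C : Finset (Fin N)) :
    ∑ j, x j = ∑ j ∈ C, x j + massOff x C := by
  classical
  rw [massOff, ← Finset.sum_union Finset.disjoint_sdiff, Finset.union_sdiff_of_subset (Finset.subset_univ C)]

/-- **The route point lies in the open simplex of the common support.** [folklore] -/
theorem routePt_mem_openSimplex {x : Fin N → ℝ} {I C : Finset (Fin N)} (hx : x ∈ openSimplex ℝ (coordSimplex I))
    (hC : C ⊆ I) (hCne : C.Nonempty) : routePt x C ∈ openSimplex ℝ (coordSimplex C) := by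
  classical
  obtain ⟨hpos, hzero, hsum⟩ := mem_openSimplex_coordSimplex_iff.1 hx
  have hS : 0 < ∑ j ∈ C, x j := Finset.sum_pos (fun j hj => hpos j (hC hj)) hCne
  rw [mem_openSimplex_coordSimplex_iff]
  refine ⟨fun j hj => ?_, fun j hj => ?_, ?_⟩
  · simp only [routePt, if_pos hj]
    exact div_pos (hpos j (hC hj)) hS
  · simp only [routePt, if_neg hj]
  · simp only [routePt]
    rw [← Finset.sum_subset (Finset.subset_univ C) (fun j _ hj => by rw [if_neg hj])]
    rw [Finset.sum_congr rfl (fun j hj => if_pos hj), ← Finset.sum_div, div_self hS.ne']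

/-- **Distance to the route point**: `‖x - routePt x C‖ ≤ 2 · massOff x C` as soon as the mass
off `C` is at most `1/2` (sup norm). [folklore] -/
theorem norm_sub_routePt_le {x : Fin N → ℝ} {I C : Finset (Fin N)} (hx : x ∈ openSimplex ℝ (coordSimplex I))
    (hm : massOff x C ≤ 1 / 2) : ‖x - routePt x C‖ ≤ 2 * massOff x C := by
  classical
  obtain ⟨hpos, hzero, hsum⟩ := mem_openSimplex_coordSimplex_iff.1 hx
  have hnn : ∀ j, 0 ≤ x j := fun j => by
    by_cases hj : j ∈ I; exact (hpos j hj).le; rw [hzero j hj]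
  have hm0 : 0 ≤ massOff x C := Finset.sum_nonneg fun j _ => hnn j
  have hS : ∑ j ∈ C, x j = 1 - massOff x C := by
    have := sum_eq_sum_add_massOff x C; rw [hsum] at this; linarith
  have hSpos : 1 / 2 ≤ ∑ j ∈ C, x j := by rw [hS]; linarith
  refine (pi_norm_le_iff_of_nonneg (by linarith)).mpr fun i => ?_
  rw [Pi.sub_apply, Real.norm_eq_abs]
  by_cases hi : i ∈ C
  · simp only [routePt, if_pos hi]
    have hxi1 : x i ≤ 1 := by
      rw [← hsum]; exact Finset.single_le_sum (fun k _ => hnn k) (Finset.mem_univ i)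
    have hS' : (0 : ℝ) < 1 - massOff x C := by linarith
    have : x i - x i / ∑ j ∈ C, x j = -(x i * massOff x C / ∑ j ∈ C, x j) := by
      rw [hS]
      field_simp
      ring
    rw [this, abs_neg, hS, abs_of_nonneg (div_nonneg (mul_nonneg (hnn i) hm0) hS'.le)]
    rw [div_le_iff₀ hS']
    nlinarith [hnn i]
  · simp only [routePt, if_neg hi, sub_zero, abs_of_nonneg (hnn i)]
    by_cases hiI : i ∈ I
    · -- `x i` is part of the mass off `C`
      have : x i ≤ massOff x C :=
        Finset.single_le_sum (fun k _ => hnn k) (Finset.mem_sdiff.mpr ⟨Finset.mem_univ i, hi⟩)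
      linarith
    · rw [hzero i hiI]; linarith

/-- The mass of `x` off the common support is small: `massOff x (supp x ∩ supp y) ≤ N ‖x - y‖`.
[folklore] -/
theorem massOff_inter_le {x y : Fin N → ℝ} {I : Finset (Fin N)} (hx : x ∈ openSimplex ℝ (coordSimplex I)) :
    massOff x (supp x ∩ supp y) ≤ N * ‖x - y‖ := by
  classical
  obtain ⟨hpos, hzero, -⟩ := mem_openSimplex_coordSimplex_iff.1 hx
  have hle : ∀ j ∈ Finset.univ \ (supp x ∩ supp y), x j ≤ ‖x - y‖ := by
    intro j hj
    rw [Finset.mem_sdiff, Finset.mem_inter, not_and_or] at hj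
    rcases hj.2 with h | h
    · rw [mem_supp_iff, not_not] at h
      rw [h]; exact norm_nonneg _
    · rw [mem_supp_iff, not_not] at h
      have := norm_le_pi_norm (x - y) j
      rw [Pi.sub_apply, h, sub_zero, Real.norm_eq_abs] at this
      exact (le_abs_self _).trans this
  calc massOff x (supp x ∩ supp y) ≤ ∑ _j ∈ Finset.univ \ (supp x ∩ supp y), ‖x - y‖ :=
        Finset.sum_le_sum hle
    _ = ((Finset.univ \ (supp x ∩ supp y)).card : ℝ) * ‖x - y‖ := by
        rw [Finset.sum_const, nsmul_eq_mul]
    _ ≤ N * ‖x - y‖ := by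
        gcongr
        exact_mod_cast (Finset.card_le_univ _).trans_eq (Fintype.card_fin N)

end Route

/-! ## The Whitney field estimate on a coordinate complex -/

section Field

variable {N : ℕ} {M : Type*} [NormedAddCommGroup M] [NormedSpace ℝ M] [CompleteSpace M]

/-- Points of the underlying space of a coordinate complex lie in the open simplex of their
support, which is a face. [folklore] -/
theorem face_supp_of_mem_space {K : Geometry.SimplicialComplex ℝ (Fin N → ℝ)} (hK : IsCoordinate K)
    {x : Fin N → ℝ} (hx : x ∈ K.space) :
    coordSimplex (supp x) ∈ K.faces ∧ x ∈ openSimplex ℝ (coordSimplex (supp x)) := by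
  obtain ⟨s, hs, hxs⟩ := Geometry.SimplicialComplex.mem_space_iff.1 hx
  obtain ⟨I, rfl, hI⟩ := hK.exists_eq_stdFace hs
  rw [hI] at hxs
  obtain ⟨hmem, hsub⟩ := mem_openSimplex_coordSimplex_supp hxs
  have hne : (coordSimplex (supp x)).Nonempty := by
    obtain ⟨-, -, hsum⟩ := mem_openSimplex_coordSimplex_iff.1 hmem
    by_contra h
    rw [Finset.not_nonempty_iff_eq_empty] at h
    have hsupp : supp x = ∅ := by
      by_contra h'
      obtain ⟨j, hj⟩ := Finset.nonempty_iff_ne_empty.mpr h'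
      have : (Pi.single j 1 : Fin N → ℝ) ∈ coordSimplex (supp x) := single_mem_coordSimplex_iff.2 hj
      rw [h] at this
      exact absurd this (Finset.notMem_empty _)
    obtain ⟨-, hzero, -⟩ := mem_openSimplex_coordSimplex_iff.1 hmem
    have : ∑ j, x j = 0 := Finset.sum_eq_zero fun j _ => hzero j (by rw [hsupp]; exact Finset.notMem_empty j)
    rw [this] at hsum
    exact zero_ne_one hsum
  exact ⟨K.down_closed hs (coordSimplex_subset_iff.2 hsub) hne, hmem⟩

/-- Faces below a face of a coordinate complex, by index sets. [folklore] -/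
theorem face_of_subset {K : Geometry.SimplicialComplex ℝ (Fin N → ℝ)} {I C : Finset (Fin N)}
    (hI : coordSimplex I ∈ K.faces) (hC : C ⊆ I) (hCne : C.Nonempty) : coordSimplex C ∈ K.faces := by
  refine K.down_closed hI (coordSimplex_subset_iff.2 hC) ?_
  obtain ⟨j, hj⟩ := hCne
  exact ⟨_, single_mem_coordSimplex_iff.2 hj⟩

/-- The remainder estimate along a segment inside a closed face of a coordinate complex.
[cite: EvansGariepy2015, §6.5 (hypothesis (⋆))] -/
theorem norm_sub_sub_le_on_stdFace {K : Geometry.SimplicialComplex ℝ (Fin N → ℝ)}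
    {G : (Fin N → ℝ) → M} {A : (Fin N → ℝ) → (Fin N → ℝ) →L[ℝ] M}
    (hG : ContinuousOn G K.space) (hA : ContinuousOn A K.space)
    (hderiv : ∀ J : Finset (Fin N), coordSimplex J ∈ K.faces →
      ∀ z ∈ openSimplex ℝ (coordSimplex J), ∀ w ∈ coordDir J,
        HasDerivAt (fun τ : ℝ => G (z + τ • w)) (A z w) 0)
    {I : Finset (Fin N)} (hI : coordSimplex I ∈ K.faces) {x y : Fin N → ℝ}
    (hx : x ∈ stdFace (I : Set (Fin N))) (hy : y ∈ stdFace (I : Set (Fin N)))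
    {η : ℝ} (hη : ∀ p ∈ stdFace (I : Set (Fin N)), ‖p - x‖ ≤ ‖y - x‖ → ‖A p - A x‖ ≤ η) :
    ‖G y - G x - A x (y - x)‖ ≤ η * ‖y - x‖ := by
  classical
  -- the pieces: open simplices of faces, indexed by index sets
  let ι := {J : Finset (Fin N) // coordSimplex J ∈ K.faces}
  haveI : Finite ι := Subtype.finite
  have hface_sub : stdFace (I : Set (Fin N)) ⊆ K.space := by
    intro p hp
    rw [← convexHull_coordSimplex] at hp
    exact Geometry.SimplicialComplex.convexHull_subset_space hI hp
  have hseg : ∀ t ∈ Icc (0 : ℝ) 1, x + t • (y - x) ∈ stdFace (I : Set (Fin N)) := fun t ht =>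
    (convex_stdFace _).add_smul_sub_mem hx hy ht
  refine norm_sub_sub_le_of_pieces (ι := ι) (fun J => openSimplex ℝ (coordSimplex J.1))
    (fun J => convex_openSimplex_coordSimplex _) (fun J => coordDir J.1)
    (fun J z hz z' hz' => sub_mem_coordDir hz hz') (fun J z hz w hw => hderiv J.1 J.2 z hz w hw)
    (fun t ht => ?_) ?_ ?_ (fun t ht => hη _ (hseg t ht) ?_)
  · obtain ⟨hmem, hsub⟩ := mem_openSimplex_coordSimplex_supp (hseg t ht)
    have hne : (supp (x + t • (y - x))).Nonempty := by
      by_contra h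
      rw [Finset.not_nonempty_iff_eq_empty] at h
      obtain ⟨-, hzero, hsum⟩ := mem_openSimplex_coordSimplex_iff.1 hmem
      have : ∑ j, (x + t • (y - x)) j = 0 :=
        Finset.sum_eq_zero fun j _ => hzero j (by rw [h]; exact Finset.notMem_empty j)
      rw [this] at hsum
      exact zero_ne_one hsum
    exact ⟨⟨supp (x + t • (y - x)), face_of_subset hI hsub hne⟩, hmem⟩
  · exact hG.comp (by fun_prop) fun t ht => hface_sub (hseg t ht)
  · exact hA.comp (by fun_prop) fun t ht => hface_sub (hseg t ht)
  · have : x + t • (y - x) - x = t • (y - x) := by abel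
    rw [this, norm_smul, Real.norm_eq_abs, abs_of_nonneg ht.1]
    calc t * ‖y - x‖ ≤ 1 * ‖y - x‖ := mul_le_mul_of_nonneg_right ht.2 (norm_nonneg _)
      _ = ‖y - x‖ := one_mul _

/-- **The Whitney field estimate on a coordinate complex** (hypothesis `(⋆)` of Whitney's
extension theorem [EvansGariepy2015, Thm. 6.10] for the field `(G, A)` on `|K|`): a continuous
map with continuous candidate derivative, differentiable along every open simplex with the
candidate as derivative, has uniform remainder `o(‖y - x‖)` on `|K|`.
[cite: EvansGariepy2015, §6.5 Thm. 6.10] -/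
theorem whitneyField_of_isCoordinate {K : Geometry.SimplicialComplex ℝ (Fin N → ℝ)} (hK : IsCoordinate K)
    {G : (Fin N → ℝ) → M} {A : (Fin N → ℝ) → (Fin N → ℝ) →L[ℝ] M}
    (hG : ContinuousOn G K.space) (hA : ContinuousOn A K.space)
    (hderiv : ∀ J : Finset (Fin N), coordSimplex J ∈ K.faces →
      ∀ z ∈ openSimplex ℝ (coordSimplex J), ∀ w ∈ coordDir J,
        HasDerivAt (fun τ : ℝ => G (z + τ • w)) (A z w) 0)
    {ε : ℝ} (hε : 0 < ε) :
    ∃ δ > 0, ∀ x ∈ K.space, ∀ y ∈ K.space, ‖x - y‖ < δ → ‖G y - G x - A x (y - x)‖ ≤ ε * ‖y - x‖ := by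
  classical
  -- uniform continuity of `A` on the compact `|K|`
  have hcompact : IsCompact K.space := hK.isCompact_space
  set η : ℝ := ε / (6 * N + 3) with hη
  have hηpos : 0 < η := by positivity
  obtain ⟨δ₁, hδ₁, hunif⟩ := Metric.uniformContinuousOn_iff.mp
    (hcompact.uniformContinuousOn_of_continuous hA) η hηpos
  refine ⟨min (1 / (2 * N + 2)) (δ₁ / (2 * N + 2)), by positivity, fun x hx y hy hxy => ?_⟩
  have hNnn : (0 : ℝ) ≤ N := Nat.cast_nonneg N
  have hxy1 : ‖x - y‖ < 1 / (2 * N + 2) := lt_of_lt_of_le hxy (min_le_left _ _)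
  have hxy2 : ‖x - y‖ < δ₁ / (2 * N + 2) := lt_of_lt_of_le hxy (min_le_right _ _)
  have hxy2' : (2 * N + 2) * ‖x - y‖ < δ₁ := by
    rwa [lt_div_iff₀ (by positivity), mul_comm] at hxy2
  -- supports and the route point
  obtain ⟨hIx, hxI⟩ := face_supp_of_mem_space hK hx
  obtain ⟨hJy, hyJ⟩ := face_supp_of_mem_space hK hy
  have hC : (supp x ∩ supp y).Nonempty := by
    refine supp_inter_nonempty (hK.space_subset_stdFace hx) (hK.space_subset_stdFace hy) ?_
    calc (N : ℝ) * ‖x - y‖ ≤ (2 * N + 2) * ‖x - y‖ := by gcongr; linarith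
      _ < 1 := by
        have := (lt_div_iff₀ (show (0:ℝ) < 2 * N + 2 by positivity)).mp hxy1
        linarith
  set C := supp x ∩ supp y with hCdef
  set z := routePt x C with hz
  have hzC : z ∈ openSimplex ℝ (coordSimplex C) := routePt_mem_openSimplex hxI Finset.inter_subset_left hC
  have hm : massOff x C ≤ N * ‖x - y‖ := massOff_inter_le hxI
  have hm2 : massOff x C ≤ 1 / 2 := by
    refine hm.trans ?_
    have := (lt_div_iff₀ (show (0:ℝ) < 2 * N + 2 by positivity)).mp hxy1
    nlinarith
  have hxz : ‖x - z‖ ≤ 2 * N * ‖x - y‖ := by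
    calc ‖x - z‖ ≤ 2 * massOff x C := norm_sub_routePt_le hxI hm2
      _ ≤ 2 * (N * ‖x - y‖) := by gcongr
      _ = 2 * N * ‖x - y‖ := by ring
  have hzy : ‖y - z‖ ≤ (2 * N + 1) * ‖x - y‖ := by
    calc ‖y - z‖ = ‖(y - x) + (x - z)‖ := by rw [sub_add_sub_cancel]
      _ ≤ ‖y - x‖ + ‖x - z‖ := norm_add_le _ _
      _ ≤ ‖x - y‖ + 2 * N * ‖x - y‖ := by rw [norm_sub_rev]; gcongr
      _ = (2 * N + 1) * ‖x - y‖ := by ring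
  -- the two segments lie in closed faces
  have hxF : x ∈ stdFace ((supp x : Finset (Fin N)) : Set (Fin N)) := by
    rw [← convexHull_coordSimplex]; exact openSimplex_subset_convexHull _ hxI
  have hzFx : z ∈ stdFace ((supp x : Finset (Fin N)) : Set (Fin N)) := by
    have : z ∈ stdFace ((C : Finset (Fin N)) : Set (Fin N)) := by
      rw [← convexHull_coordSimplex]; exact openSimplex_subset_convexHull _ hzC
    exact stdFace_mono (by exact_mod_cast (Finset.inter_subset_left : C ⊆ supp x)) this
  have hzFy : z ∈ stdFace ((supp y : Finset (Fin N)) : Set (Fin N)) := by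
    have : z ∈ stdFace ((C : Finset (Fin N)) : Set (Fin N)) := by
      rw [← convexHull_coordSimplex]; exact openSimplex_subset_convexHull _ hzC
    exact stdFace_mono (by exact_mod_cast (Finset.inter_subset_right : C ⊆ supp y)) this
  have hyF : y ∈ stdFace ((supp y : Finset (Fin N)) : Set (Fin N)) := by
    rw [← convexHull_coordSimplex]; exact openSimplex_subset_convexHull _ hyJ
  have hspace_x : stdFace ((supp x : Finset (Fin N)) : Set (Fin N)) ⊆ K.space := fun p hp => by
    rw [← convexHull_coordSimplex] at hp
    exact Geometry.SimplicialComplex.convexHull_subset_space hIx hp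
  have hspace_y : stdFace ((supp y : Finset (Fin N)) : Set (Fin N)) ⊆ K.space := fun p hp => by
    rw [← convexHull_coordSimplex] at hp
    exact Geometry.SimplicialComplex.convexHull_subset_space hJy hp
  have hzK : z ∈ K.space := hspace_x hzFx
  -- estimate on `[x, z]`
  have h1 : ‖G z - G x - A x (z - x)‖ ≤ η * ‖z - x‖ := by
    refine norm_sub_sub_le_on_stdFace hG hA hderiv hIx hxF hzFx fun p hp hpx => ?_
    rw [← dist_eq_norm]
    refine (hunif p (hspace_x hp) x hx ?_).le
    rw [dist_eq_norm]
    calc ‖p - x‖ ≤ ‖z - x‖ := hpx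
      _ = ‖x - z‖ := norm_sub_rev _ _
      _ ≤ 2 * N * ‖x - y‖ := hxz
      _ < δ₁ := by nlinarith [norm_nonneg (x - y)]
  -- estimate on `[z, y]`
  have h2 : ‖G y - G z - A z (y - z)‖ ≤ η * ‖y - z‖ := by
    refine norm_sub_sub_le_on_stdFace hG hA hderiv hJy hzFy hyF fun p hp hpz => ?_
    rw [← dist_eq_norm]
    refine (hunif p (hspace_y hp) z hzK ?_).le
    rw [dist_eq_norm]
    calc ‖p - z‖ ≤ ‖y - z‖ := hpz
      _ ≤ (2 * N + 1) * ‖x - y‖ := hzy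
      _ < δ₁ := by nlinarith [norm_nonneg (x - y)]
  -- the fields at `x` and `z` are close
  have h3 : ‖A z - A x‖ ≤ η := by
    rw [← dist_eq_norm]
    refine (hunif z hzK x hx ?_).le
    rw [dist_eq_norm, norm_sub_rev]
    calc ‖x - z‖ ≤ 2 * N * ‖x - y‖ := hxz
      _ < δ₁ := by nlinarith [norm_nonneg (x - y)]
  -- combine
  have hdecomp : G y - G x - A x (y - x) =
      (G y - G z - A z (y - z)) + (G z - G x - A x (z - x)) + (A z - A x) (y - z) := by
    have : A x (y - x) = A x (y - z) + A x (z - x) := by rw [← map_add]; congr 1; abel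
    rw [this]
    simp only [FunLike.coe_sub, Pi.sub_apply]
    abel
  rw [hdecomp]
  calc ‖(G y - G z - A z (y - z)) + (G z - G x - A x (z - x)) + (A z - A x) (y - z)‖
      ≤ ‖G y - G z - A z (y - z)‖ + ‖G z - G x - A x (z - x)‖ + ‖(A z - A x) (y - z)‖ :=
        norm_add₃_le
    _ ≤ η * ‖y - z‖ + η * ‖z - x‖ + η * ‖y - z‖ := by
        have h4 : ‖(A z - A x) (y - z)‖ ≤ η * ‖y - z‖ :=
          (ContinuousLinearMap.le_opNorm _ _).trans (mul_le_mul_of_nonneg_right h3 (norm_nonneg _))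
        linarith [h1, h2, h4]
    _ ≤ η * ((2 * N + 1) * ‖x - y‖) + η * (2 * N * ‖x - y‖) + η * ((2 * N + 1) * ‖x - y‖) := by
        gcongr
        · rw [norm_sub_rev]; exact hxz
    _ = η * (6 * N + 2) * ‖x - y‖ := by ring
    _ ≤ ε * ‖y - x‖ := by
        rw [norm_sub_rev y x, hη]
        have h6 : (0 : ℝ) < 6 * N + 3 := by positivity
        have : ε / (6 * N + 3) * (6 * N + 2) ≤ ε := by
          rw [div_mul_eq_mul_div, div_le_iff₀ h6]
          nlinarith
        exact mul_le_mul_of_nonneg_right this (norm_nonneg _)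

end Field

end Literature.ModelTheory.ExponentialFields
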